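import Mathlib
import HarnessLib
import Summits.ValiantsHypothesis.ValiantsHypothesis.Theorems.LacunarySymmetroidMatrixDescartesProductPlusOneRowTowerKCalculus
import Summits.ValiantsHypothesis.ValiantsHypothesis.Theorems.LacunarySymmetroidMatrixDescartesProductPlusOneChartForms
import Summits.ValiantsHypothesis.ValiantsHypothesis.Theorems.LacunarySymmetroidMatrixDescartesProductPlusOneLetterSumsK

/-!
# LINE (A) `product_plus_one` — the K-nomial θ-tower in LINE currency: `W(f)(x) = −f(x)²·ψ₁` for every support size, and the company sum

Companion of ✓ `…RowTowerKDefs` / `…RowTowerKCalculus`.  For a support `d : Fin (n+2) → ℕ` with bottom letter `d 0 ≤ d l` and a row `f = Σ_l C (b l) X^{d l}`,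
the stripped row is `b 0 − Σ_{l'} (−b l'.succ)·x^{d l'.succ − d 0}`, i.e. `A = b 0`, tail weights `B l' = −b l'.succ`, rates `λ l' = d l'.succ − d 0`:

* `eval_rowK_eq` — `f(x) = x^{d 0}·(b 0 − Σ_{l'} (−b l'.succ) x^{λ l'})`;
* ★ `logWronskian_rowK_eq_rowPsiK1` — `W(f)(x) = −f(x)²·rowPsiK1 λ (b 0) (−b∘succ) x` (`x > 0`, `f(x) ≠ 0`; ✓ `eval_logWronskian_fewnomial_eq`,
  ✓ `wronskianForm_shift_level` — the K = 3 case is ✓ `logWronskian_row_eq_rowPsi1`);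
* ★ `logWronskian_prodK_eq_rowPsiK1_sum` — for a company `a : Fin m → Fin (n+2) → ℝ`: `W(∏_j f_j)(x) = −(∏_j f_j(x))²·Σ_j ψ₁^{(j)}(x)` (✓ `theta_wronskian_prod`).

Honest framing: bookkeeping identities; nothing closes; `OneChangeFloorK3` / `WronskianBudgetK3` / 18050 / `MatrixDescartes` OPEN; `VP ≠ VNP` NOT proved.  No definitions.
-/

set_option linter.dupNamespace false

namespace Summit.ValiantsHypothesis.ValiantsHypothesis.Theorems.LacunarySymmetroidMatrixDescartes

namespace ProductPlusOne

open Finset Polynomial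
open scoped BigOperators Polynomial

variable {n : ℕ}

/-- `f(x) = x^{d 0}·(b 0 − Σ_{l'} (−b l'.succ)·x^{d l'.succ − d 0})` for a row on a support with bottom letter `d 0`. [this file's lemma] -/
theorem eval_rowK_eq (d : Fin (n + 2) → ℕ) (hd : ∀ l, d 0 ≤ d l) (b : Fin (n + 2) → ℝ) (x : ℝ) :
    (∑ l, C (b l) * X ^ (d l) : ℝ[X]).eval x
      = x ^ (d 0) * (b 0 - ∑ l : Fin (n + 1), (-(b l.succ)) * x ^ (d l.succ - d 0)) := by
  rw [eval_factor_eq_pow_mul_stripped d 0 hd b x, Fin.sum_univ_succ]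
  congr 1
  rw [Nat.sub_self, pow_zero, mul_one]
  have : ∑ l : Fin (n + 1), (-(b l.succ)) * x ^ (d l.succ - d 0) = -∑ l : Fin (n + 1), b l.succ * x ^ (d l.succ - d 0) := by
    rw [← Finset.sum_neg_distrib]
    exact Finset.sum_congr rfl fun l _ => by ring
  rw [this]
  ring

/-- The shifted moments of the row: `Σ_l (d_l − d_0)^k·(b_l x^{d_l}) = −x^{d 0}·rowHK λ k (−b∘succ) x` for `k = 1, 2`. [this file's lemma] -/
theorem shifted_moment_eq (d : Fin (n + 2) → ℕ) (hd : ∀ l, d 0 ≤ d l) (b : Fin (n + 2) → ℝ) (x : ℝ) (k : ℕ) (hk : k ≠ 0) :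
    ∑ l, ((d l : ℝ) - d 0) ^ k * (b l * x ^ (d l))
      = -(x ^ (d 0)) * rowHK (fun l : Fin (n + 1) => d l.succ - d 0) k (fun l => -(b l.succ)) x := by
  unfold rowHK
  rw [Fin.sum_univ_succ, sub_self, zero_pow hk, zero_mul, zero_add, Finset.mul_sum]
  refine Finset.sum_congr rfl fun l _ => ?_
  dsimp only
  have hcast : ((d l.succ : ℕ) : ℝ) - (d 0 : ℝ) = ((d l.succ - d 0 : ℕ) : ℝ) := by
    rw [Nat.cast_sub (hd l.succ)]
  have hpow : x ^ (d l.succ) = x ^ (d 0) * x ^ (d l.succ - d 0) := by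
    rw [← pow_add, Nat.add_sub_cancel' (hd l.succ)]
  rw [hcast, hpow]
  ring

/-- ★ **`W(f)(x) = −f(x)²·ψ₁`** for a row on ANY support (`x > 0`, `f(x) ≠ 0`); `ψ₁ = rowPsiK1 λ (b 0) (−b∘succ) x`, `λ l' = d l'.succ − d 0`. [this file's theorem] -/
theorem logWronskian_rowK_eq_rowPsiK1 (d : Fin (n + 2) → ℕ) (hd : ∀ l, d 0 ≤ d l) (b : Fin (n + 2) → ℝ) {x : ℝ} (hx : 0 < x)
    (hF : (∑ l, C (b l) * X ^ (d l) : ℝ[X]).eval x ≠ 0) :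
    ((∑ l, C (b l) * X ^ (d l) : ℝ[X]) * (X * derivative (X * derivative (∑ l, C (b l) * X ^ (d l) : ℝ[X])))
        - (X * derivative (∑ l, C (b l) * X ^ (d l) : ℝ[X])) ^ 2).eval x
      = -((∑ l, C (b l) * X ^ (d l) : ℝ[X]).eval x) ^ 2
          * rowPsiK1 (fun l : Fin (n + 1) => d l.succ - d 0) (b 0) (fun l => -(b l.succ)) x := by
  -- the stripped row does not vanish
  have hg : b 0 - ∑ l : Fin (n + 1), (-(b l.succ)) * x ^ (d l.succ - d 0) ≠ 0 := by
    intro h0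
    apply hF
    rw [eval_rowK_eq d hd b x, h0, mul_zero]
  rw [eval_logWronskian_fewnomial_eq d b x]
  have hshift := wronskianForm_shift_level (fun l => (d l : ℝ)) (fun l => b l * x ^ (d l)) (d 0 : ℝ) 0
  simp only [zero_mul, sub_zero] at hshift
  rw [hshift]
  have hM2 : ∑ l, ((d l : ℝ) - d 0) * ((d l : ℝ) - d 0) * (b l * x ^ (d l))
      = -(x ^ (d 0)) * rowHK (fun l : Fin (n + 1) => d l.succ - d 0) 2 (fun l => -(b l.succ)) x := by
    rw [← shifted_moment_eq d hd b x 2 two_ne_zero]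
    exact Finset.sum_congr rfl fun l _ => by ring
  have hM1 : ∑ l, ((d l : ℝ) - d 0) * (b l * x ^ (d l))
      = -(x ^ (d 0)) * rowHK (fun l : Fin (n + 1) => d l.succ - d 0) 1 (fun l => -(b l.succ)) x := by
    rw [← shifted_moment_eq d hd b x 1 one_ne_zero]
    exact Finset.sum_congr rfl fun l _ => by ring
  have hF' : ∑ l, b l * x ^ (d l) = x ^ (d 0) * (b 0 - ∑ l : Fin (n + 1), (-(b l.succ)) * x ^ (d l.succ - d 0)) := by
    rw [← eval_rowK_eq d hd b x, eval_fewnomial]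
  rw [hM2, hM1, hF', eval_rowK_eq d hd b x]
  unfold rowPsiK1 rowUK
  dsimp only
  set g := b 0 - ∑ l : Fin (n + 1), (-(b l.succ)) * x ^ (d l.succ - d 0) with hgdef
  set H1 := rowHK (fun l : Fin (n + 1) => d l.succ - d 0) 1 (fun l => -(b l.succ)) x with hH1
  set H2 := rowHK (fun l : Fin (n + 1) => d l.succ - d 0) 2 (fun l => -(b l.succ)) x with hH2
  field_simp
  ring

/-- ★ **The company**: `W(∏_j f_j)(x) = −(∏_j f_j(x))²·Σ_j ψ₁^{(j)}(x)` (`x > 0`, no row vanishing at `x`), every support size. [this file's theorem] -/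
theorem logWronskian_prodK_eq_rowPsiK1_sum {m : ℕ} (d : Fin (n + 2) → ℕ) (hd : ∀ l, d 0 ≤ d l) (a : Fin m → Fin (n + 2) → ℝ)
    {x : ℝ} (hx : 0 < x) (hf : ∀ j, (∑ l, C (a j l) * X ^ (d l) : ℝ[X]).eval x ≠ 0) :
    ((∏ j, ∑ l, C (a j l) * X ^ (d l) : ℝ[X]) * (X * derivative (X * derivative (∏ j, ∑ l, C (a j l) * X ^ (d l) : ℝ[X])))
        - (X * derivative (∏ j, ∑ l, C (a j l) * X ^ (d l) : ℝ[X])) ^ 2).eval x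
      = -((∏ j, (∑ l, C (a j l) * X ^ (d l) : ℝ[X])).eval x) ^ 2
          * ∑ j, rowPsiK1 (fun l : Fin (n + 1) => d l.succ - d 0) (a j 0) (fun l => -(a j l.succ)) x := by
  classical
  have hW := congrArg (Polynomial.eval x) (theta_wronskian_prod (fun j => (∑ l, C (a j l) * X ^ (d l) : ℝ[X])))
  rw [eval_finsetSum] at hW
  rw [hW, eval_prod, Finset.mul_sum]
  refine Finset.sum_congr rfl fun j _ => ?_
  rw [eval_mul, logWronskian_rowK_eq_rowPsiK1 d hd (a j) hx (hf j), eval_prod]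
  simp only [eval_pow]
  rw [← Finset.mul_prod_erase Finset.univ (fun i => (∑ l, C (a i l) * X ^ (d l) : ℝ[X]).eval x) (Finset.mem_univ j),
    mul_pow, ← Finset.prod_pow]
  ring

end ProductPlusOne

end Summit.ValiantsHypothesis.ValiantsHypothesis.Theorems.LacunarySymmetroidMatrixDescartes
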